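import Mathlib.Analysis.Calculus.IteratedDeriv.Lemmas
import Mathlib.Analysis.Calculus.Deriv.Abs
import Literature.Analysis.Calculus.LogCutoff
import HarnessLib

/-!
# K1loc, line `Spectral` / SeqCone — helper: ALL-ORDERS DERIVATIVE BOUNDS FOR SMOOTH-STEP PROFILES (S-B Taylor data)

Helper file of the prover lane on the crux `K1LocalisedCascade` (stmt-AnomalousDissipation-19491), route
`SawtoothPulseCascade` (memo v6 addendum §C).  The discrete Taylor hypothesis of the higher-order expansion
(`…SlotTaylorSymbol.symbol_taylor_hT`) asks for sup bounds of `iteratedDeriv α M` of the fibre symbols `M`; the symbols of the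
assembly (`…SymbolCone`, memo v6 §2) are built from Mathlib's `Real.smoothTransition` composed with AFFINE maps of `t` or of `|t|`
(radial cut-off `ψ((|t| − L)/(εL))`, cone cut-off `φ` of `γ|t|/|n|`).  This file proves:
* `iteratedDeriv_smoothTransition_of_neg` / `_of_one_lt` — all derivatives of order `≥ 1` vanish off `[0,1]`;
* `exists_bound_iteratedDeriv_smoothTransition` — `∃ C_n ≥ 0, |smoothTransition⁽ⁿ⁾| ≤ C_n` on `ℝ` (continuity on `[0,1]`);
* `iteratedDeriv_comp_affine` — `(F((· − a)/b))⁽ⁿ⁾(t) = b⁻ⁿ F⁽ⁿ⁾((t − a)/b)` for `F` of class `Cⁿ`;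
* `abs_iteratedDeriv_smoothTransition_affine_le` — `|(smoothTransition((· − a)/b))⁽ⁿ⁾| ≤ C_n/|b|ⁿ`;
* `abs_iteratedDeriv_smoothTransition_affine_abs_le` — the same for `t ↦ smoothTransition((|t| − a)/b)` when `a, b > 0` (the
  profile is locally constant near `t = 0`, so `|t|` costs nothing): the scale-`b` bounds the symbol bookkeeping needs.
No definitions; no statement about the stub.  [cite: Grafakos2014, Prop. 3.1.2 (5)] [problem: turb]
-/

-- `Summit.<Summit>.<Problem>`: single-conjunct summit, the duplicate namespace segment is deliberate.
set_option linter.dupNamespace false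

noncomputable section

namespace Summit.AnomalousDissipation.AnomalousDissipation.Theorems.SawtoothPulseCascade.K1Cutoff

open Set Filter Topology Real

/-! ## Derivatives of the smooth transition vanish off `[0,1]` and are bounded -/

/-- On `(−∞,0)` every iterated derivative of the smooth transition vanishes (the function is `0` there). [folklore] -/
theorem iteratedDeriv_smoothTransition_of_neg (n : ℕ) {x : ℝ} (hx : x < 0) : iteratedDeriv n smoothTransition x = 0 := by
  have h : smoothTransition =ᶠ[𝓝 x] fun _ => (0 : ℝ) :=
    (eventually_lt_nhds hx).mono fun y hy => Real.smoothTransition.zero_of_nonpos hy.le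
  rw [h.iteratedDeriv_eq n, iteratedDeriv_const]
  split_ifs <;> rfl

/-- On `(1,∞)` every iterated derivative of order `n ≥ 1` of the smooth transition vanishes (the function is `1` there).
[folklore] -/
theorem iteratedDeriv_smoothTransition_of_one_lt {n : ℕ} (hn : n ≠ 0) {x : ℝ} (hx : 1 < x) :
    iteratedDeriv n smoothTransition x = 0 := by
  have h : smoothTransition =ᶠ[𝓝 x] fun _ => (1 : ℝ) :=
    (eventually_gt_nhds hx).mono fun y hy => Real.smoothTransition.one_of_one_le hy.le
  rw [h.iteratedDeriv_eq n, iteratedDeriv_const, if_neg hn]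

/-- **All iterated derivatives of the smooth transition are bounded on `ℝ`.** [folklore] -/
theorem exists_bound_iteratedDeriv_smoothTransition (n : ℕ) :
    ∃ C : ℝ, 0 ≤ C ∧ ∀ x, |iteratedDeriv n smoothTransition x| ≤ C := by
  have hc : Continuous (iteratedDeriv n smoothTransition) :=
    Real.smoothTransition.contDiff.continuous_iteratedDeriv n (by exact_mod_cast le_top)
  obtain ⟨C, hC⟩ := isCompact_Icc.exists_bound_of_continuousOn (hc.continuousOn (s := Icc (0 : ℝ) 1))
  refine ⟨max C 1, le_max_of_le_right zero_le_one, fun x => ?_⟩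
  by_cases hx : x ∈ Icc (0 : ℝ) 1
  · exact ((Real.norm_eq_abs _).symm.le.trans (hC x hx)).trans (le_max_left _ _)
  · rw [mem_Icc, not_and_or, not_le, not_le] at hx
    rcases hx with hx | hx
    · rw [iteratedDeriv_smoothTransition_of_neg n hx, abs_zero]; exact le_max_of_le_right zero_le_one
    · rcases Nat.eq_zero_or_pos n with hn | hn
      · subst hn
        rw [iteratedDeriv_zero, abs_of_nonneg (Real.smoothTransition.nonneg x)]
        exact (Real.smoothTransition.le_one x).trans (le_max_right _ _)
      · rw [iteratedDeriv_smoothTransition_of_one_lt hn.ne' hx, abs_zero]; exact le_max_of_le_right zero_le_one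

/-! ## Affine reparametrisation -/

/-- **Iterated derivatives of an affine reparametrisation**: `(F((· − a)/b))⁽ⁿ⁾(t) = b⁻ⁿ·F⁽ⁿ⁾((t − a)/b)` for `F ∈ Cⁿ`.
[folklore] -/
theorem iteratedDeriv_comp_affine {F : ℝ → ℝ} {n : ℕ} (hF : ContDiff ℝ n F) (a b t : ℝ) :
    iteratedDeriv n (fun t => F ((t - a) / b)) t = (b⁻¹) ^ n * iteratedDeriv n F ((t - a) / b) := by
  have h1 : (fun t => F ((t - a) / b)) = fun t => (fun s => F (b⁻¹ * s)) (t - a) := by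
    funext s; simp only [div_eq_inv_mul]
  rw [h1, iteratedDeriv_comp_sub_const n (fun s => F (b⁻¹ * s)) a]
  simp only
  rw [iteratedDeriv_comp_const_mul hF b⁻¹, div_eq_inv_mul]

/-- **Scale-`b` bounds for the affine smooth step**: `|(smoothTransition((· − a)/b))⁽ⁿ⁾(t)| ≤ C_n/|b|ⁿ` with the bound `C_n` of
`exists_bound_iteratedDeriv_smoothTransition`. [folklore] -/
theorem abs_iteratedDeriv_smoothTransition_affine_le {n : ℕ} {C : ℝ} (hC : ∀ x, |iteratedDeriv n smoothTransition x| ≤ C)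
    (a b t : ℝ) : |iteratedDeriv n (fun t => smoothTransition ((t - a) / b)) t| ≤ C / |b| ^ n := by
  rw [iteratedDeriv_comp_affine (Real.smoothTransition.contDiff (n := n)) a b t, abs_mul, abs_pow, abs_inv]
  calc |b|⁻¹ ^ n * |iteratedDeriv n smoothTransition ((t - a) / b)| ≤ |b|⁻¹ ^ n * C :=
        mul_le_mul_of_nonneg_left (hC _) (by positivity)
    _ = C / |b| ^ n := by rw [inv_pow]; ring

/-! ## Profiles of `|t|` that are constant near `0` -/

/-- **Scale-`b` bounds for the smooth step of `|t|`**: for `a, b > 0` the profile `t ↦ smoothTransition((|t| − a)/b)` (equal to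
`0` for `|t| ≤ a`, to `1` for `|t| ≥ a + b`) has `|n`-th derivative`| ≤ C_n/bⁿ` everywhere: away from `0` it is the affine step of
`±t`, near `0` it is locally constant. [folklore] -/
theorem abs_iteratedDeriv_smoothTransition_affine_abs_le {n : ℕ} {C : ℝ} (hC : ∀ x, |iteratedDeriv n smoothTransition x| ≤ C)
    {a b : ℝ} (ha : 0 < a) (hb : 0 < b) (t : ℝ) :
    |iteratedDeriv n (fun t => smoothTransition ((|t| - a) / b)) t| ≤ C / b ^ n := by
  have hC0 : 0 ≤ C := (abs_nonneg _).trans (hC 0)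
  rcases lt_trichotomy t 0 with ht | ht | ht
  · -- near `t < 0` the profile is the affine step of `−t`
    have h : (fun t => smoothTransition ((|t| - a) / b)) =ᶠ[𝓝 t] fun t => smoothTransition ((-t - a) / b) :=
      (eventually_lt_nhds ht).mono fun y hy => by simp only [abs_of_neg hy]
    rw [h.iteratedDeriv_eq n]
    have h2 : (fun t => smoothTransition ((-t - a) / b)) = fun t => (fun s => smoothTransition ((s - a) / b)) (-t) := rfl
    rw [h2, iteratedDeriv_comp_neg n (fun s => smoothTransition ((s - a) / b)) t, smul_eq_mul, abs_mul, abs_pow, abs_neg,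
      abs_one, one_pow, one_mul]
    have := abs_iteratedDeriv_smoothTransition_affine_le hC a b (-t)
    rwa [abs_of_pos hb] at this
  · -- near `0` the profile vanishes identically (`|t| < a`)
    subst ht
    have h : (fun t => smoothTransition ((|t| - a) / b)) =ᶠ[𝓝 (0 : ℝ)] fun _ => (0 : ℝ) := by
      have hopen : IsOpen {y : ℝ | |y| < a} := isOpen_lt continuous_abs continuous_const
      filter_upwards [hopen.mem_nhds (show (0 : ℝ) ∈ {y : ℝ | |y| < a} by simpa using ha)] with y hy
      have hy' : |y| < a := hy
      exact Real.smoothTransition.zero_of_nonpos (div_nonpos_of_nonpos_of_nonneg (by linarith) hb.le)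
    rw [h.iteratedDeriv_eq n, iteratedDeriv_const]
    simp only [ite_self, abs_zero]
    positivity
  · have h : (fun t => smoothTransition ((|t| - a) / b)) =ᶠ[𝓝 t] fun t => smoothTransition ((t - a) / b) :=
      (eventually_gt_nhds ht).mono fun y hy => by simp only [abs_of_pos hy]
    rw [h.iteratedDeriv_eq n]
    have := abs_iteratedDeriv_smoothTransition_affine_le hC a b t
    rwa [abs_of_pos hb] at this

/-! ## The cone/radial fibre profiles `1 − c + c·smoothTransition((|t| − a)/b)` (appended) -/

/-- The smooth step of `|t|` is smooth at every point when `a, b > 0` (near `0` it is identically `0`). [folklore] -/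
theorem contDiffAt_smoothTransition_affine_abs {a b : ℝ} (ha : 0 < a) (hb : 0 < b) {n : ℕ∞} (t : ℝ) :
    ContDiffAt ℝ n (fun t => smoothTransition ((|t| - a) / b)) t := by
  rcases eq_or_ne t 0 with h0 | h0
  · subst h0
    have h : (fun t => smoothTransition ((|t| - a) / b)) =ᶠ[𝓝 (0 : ℝ)] fun _ => (0 : ℝ) := by
      have hopen : IsOpen {y : ℝ | |y| < a} := isOpen_lt continuous_abs continuous_const
      filter_upwards [hopen.mem_nhds (show (0 : ℝ) ∈ {y : ℝ | |y| < a} by simpa using ha)] with y hy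
      have hy' : |y| < a := hy
      exact Real.smoothTransition.zero_of_nonpos (div_nonpos_of_nonpos_of_nonneg (by linarith) hb.le)
    exact contDiffAt_const.congr_of_eventuallyEq h
  · exact Real.smoothTransition.contDiffAt.comp t (((contDiffAt_abs h0).sub contDiffAt_const).div_const b)

/-- **Taylor data of the fibre profiles of the cone/radial symbols.**  For `a, b > 0`, `|c| ≤ 1` and `r ≥ 1`:
`|(1 − c + c·smoothTransition((|·| − a)/b))⁽ʳ⁾(t)| ≤ C_r/bʳ` with the bound `C_r` of
`exists_bound_iteratedDeriv_smoothTransition` — on the H fibre `k_h = n` the old symbol `μ = 1 − ψ(|n|/L)φ(γ|t|/|n|)` of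
`…SymbolCone` has this form with `c = ψ(|n|/L)`, `a = a₀|n|/γ`, `b = ε_a|n|/γ`, so its Taylor constants scale like
`(γ/(ε_a|n|))ʳ ≤ (γ/(ε_a L))ʳ`. [cite: Grafakos2014, Prop. 3.1.2 (5)] -/
theorem abs_iteratedDeriv_coneProfile_le {r : ℕ} (hr : 0 < r) {C : ℝ} (hC : ∀ x, |iteratedDeriv r smoothTransition x| ≤ C)
    {a b c : ℝ} (ha : 0 < a) (hb : 0 < b) (hc : |c| ≤ 1) (t : ℝ) :
    |iteratedDeriv r (fun t => 1 - c + c * smoothTransition ((|t| - a) / b)) t| ≤ C / b ^ r := by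
  have hC0 : 0 ≤ C := (abs_nonneg _).trans (hC 0)
  have h1 : iteratedDeriv r (fun t => 1 - c + c * smoothTransition ((|t| - a) / b)) t =
      iteratedDeriv r (fun t => c * smoothTransition ((|t| - a) / b)) t :=
    iteratedDeriv_const_add hr (1 - c)
  rw [h1, iteratedDeriv_const_mul c (contDiffAt_smoothTransition_affine_abs ha hb t), abs_mul]
  calc |c| * |iteratedDeriv r (fun t => smoothTransition ((|t| - a) / b)) t| ≤ 1 * (C / b ^ r) :=
        mul_le_mul hc (abs_iteratedDeriv_smoothTransition_affine_abs_le hC ha hb t) (abs_nonneg _) zero_le_one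
    _ = C / b ^ r := one_mul _

end Summit.AnomalousDissipation.AnomalousDissipation.Theorems.SawtoothPulseCascade.K1Cutoff
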